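/-
  stub-ideation k = 2 (g40) · technique «literature transfer (recent-theorem-open-question harvest;
  typed dictionary)» · crux `SplitBadTwoLowerHalfOfFacts` · stub `stub_heegnerIndexLowerAtTwo`.

  WHAT THIS FILE TYPES (nothing here proves BSD, the crux, or the stub): the R197a″ «(KLF-COSET)₂»
  conjunct A′ of STUB-PLAN v7.3 — de Shalit II.5.2 (4) [the p-adic Kronecker limit formula on the
  𝔭-RAMIFIED finite-order cosets, with the Gauss sum 4.11 (30) ≡ 4.8 (19)] — as ONE extra conjunct
  `IsCosetValues ι v vbar S 𝒰 μ` on the SAME witness `μ` of the existing named fact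
  `DeShalit1987.thmII414_exists_lMeasure`, with the elliptic unit NAMED by tree objects
  (`PeriodPair.deShalitTheta`, `rayClassField`, `algClosureEmb`, `artinSymbol (galFrob …)`), every
  constant gauge-named (12, `χ⁻¹(𝔞) − N𝔞`, `p⁻ⁿ`, the orientation `ζ ↦ exp(2πi/pⁿ)`), plus the
  kernel projection `A′ → A` and small kernel helpers.  Sorries only in the named `stubsig_*`
  signatures at the end (helper-lemma SHAPES for the stub prover / typer, not claims).
-/
import Literature.NumberTheory.EllipticCurves.DeShalit1987.LMeasureExistence
import Literature.NumberTheory.ComplexMultiplication.EllipticUnits.ThetaSingularValues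
import Literature.NumberTheory.LocalFields.PadicComplexLog
import HarnessLib

noncomputable section

open scoped Classical
open NumberField IsDedekindDomain Field Complex
open Literature.NumberTheory.GaloisRepresentations
open Literature.NumberTheory.EllipticCurves
open Literature.NumberTheory.ComplexMultiplication.EllipticUnits
open Literature.NumberTheory.NumberFields (rayClassField)
open Literature.NumberTheory.LFunctions.AbelianDensity (artinSymbol)
open Literature.NumberTheory.LocalFields (PadicComplex.iwasawaLog)

set_option linter.dupNamespace false

namespace Summit.BirchSwinnertonDyer.BirchSwinnertonDyer.Cruxes.SplitBadTwoLowerHalfOfFacts.CosetValuesK2G40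

variable {p : ℕ} [Fact p.Prime] {K : Type} [Field K] [NumberField K]

/-! ## §1 Currency: complex values moved into `ℂ_p` by `ι⁻¹`, `K̄ → ℂ → ℂ_p` -/

/-- `ι⁻¹ z ∈ ℂ_p` for a unit `z ∈ ℂˣ` (values of finite-order characters). -/
def cval (ι : PadicAlgCl p ≃+* ℂ) (z : ℂˣ) : ℂ_[p] :=
  ((ι.symm ((z : ℂˣ) : ℂ) : PadicAlgCl p) : ℂ_[p])

/-- The `p`-adic embedding `j_p = ι⁻¹ ∘ ι̂ : K̄ → ℂ → ℂ_p` attached to `ιK : K → ℂ`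
(`ι̂ = algClosureEmb ιK`, de Shalit's `i_p = ι⁻¹ ∘ i_∞`). -/
def pEmb (ι : PadicAlgCl p ≃+* ℂ) (ιK : K →+* ℂ) (x : AlgebraicClosure K) : ℂ_[p] :=
  ((ι.symm (algClosureEmb ιK x) : PadicAlgCl p) : ℂ_[p])

/-- The Galois group `Gal(K(𝔤)/K)` of the ray class field (finite abelian). -/
abbrev RayGal (K : Type) [Field K] [NumberField K] (𝔤 : Ideal (𝓞 K)) : Type :=
  rayClassField K 𝔤 ≃ₐ[K] rayClassField K 𝔤

/-- The integrand `ρ = χ̂⁻¹ : Γ_K → ℂ_p` of a character `χ` of `Gal(K(𝔤)/K)`: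
`σ ↦ ι⁻¹(χ(σ|_{K(𝔤)})⁻¹)` — de Shalit's convention `L_{p,𝔣}(χ) = ∫ χ⁻¹ dμ(𝔣)` (II.4.16 (49),
II.5.2: "the integral of `χ⁻¹` (and not of `χ`)"), matching the avatar convention of
`DeShalit1987.IsPAdicAvatarOutside` (`e = χ̂⁻¹`). -/
def galCharInv (ι : PadicAlgCl p ≃+* ℂ) (𝔤 : Ideal (𝓞 K)) (χ : RayGal K 𝔤 →* ℂˣ) :
    absoluteGaloisGroup K → ℂ_[p] :=
  fun σ ↦ cval ι (χ (absRestrictNormalHom (rayClassField K 𝔤) σ))⁻¹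

/-! ## §2 The Gauss sum `G(χ⁻¹)` — de Shalit II.4.11 (30) ≡ `χ⁻¹(γ₀)·τ_{γ₀ζ}(χ⁻¹)`, 4.8 (19)

`𝔮`-free (K51 / row 110 «any γ₀ restricting to `(𝔭ⁿ, F′/K)` on `F′ = K(𝔣𝔭̄^∞)`»): for such `γ₀`,
`G(χ⁻¹) = p⁻ⁿ · χ⁻¹(γ₀|_{K(𝔤)}) · Σ_{a ∈ (ℤ/pⁿ)ˣ} χ⁻¹(δ_a) · j_p(γ₀ ζ)^{−a}`, where
`δ_a = ((α_a), K(𝔤)/K)`, `α_a ≡ 1 (𝔣)`, `α_a ≡ a (vⁿ)` parametrises `Gal(K(𝔤)/K(𝔣)) ≅ (𝒪/𝔭ⁿ)ˣ`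
by `κ` (action on `E[𝔭ⁿ]`), and `ζ ∈ K̄` is the ORIENTATION `ι̂ ζ = exp(2πi/pⁿ)` (de Shalit II.4.4:
"fix once and for all a generator (ς_n) … orienting ℂ_p"; μ depends on it, II.4.6).  The value is
independent of the choices of `γ₀` (coset shift `δ_c` cancels against `ζ ↦ ζ^c`) and `α`. -/
def gaussSumInv (ι : PadicAlgCl p ≃+* ℂ) (ιK : K →+* ℂ) (𝔤 : Ideal (𝓞 K)) (n : ℕ)
    (χ : RayGal K 𝔤 →* ℂˣ) (γ₀ : absoluteGaloisGroup K) (ζ : AlgebraicClosure K)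
    (α : (ZMod (p ^ n))ˣ → 𝓞 K) : ℂ_[p] :=
  ((p : ℂ_[p]) ^ n)⁻¹ * cval ι (χ (absRestrictNormalHom (rayClassField K 𝔤) γ₀))⁻¹ *
    ∑ a : (ZMod (p ^ n))ˣ,
      cval ι (χ (artinSymbol (galFrob K (rayClassField K 𝔤)) (Ideal.span {α a})))⁻¹ *
        ((pEmb ι ιK (γ₀ • ζ)) ^ (a : ZMod (p ^ n)).val)⁻¹

/-! ## §3 The elliptic-unit side `Σ_{𝔠 ∈ Cl(𝔤)} χ(𝔠) · log σ_𝔠(e_n(𝔞))`, `e_n(𝔞) = Θ(1; 𝔤, 𝔞)` -/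

/-- `Σ_{g ∈ Gal(K(𝔤)/K)} ι⁻¹χ(g) · Log j_p(g u)` — the right-hand sum of II.5.2 (4) with the ray
classes `𝔠` replaced by their Artin symbols `g = σ_𝔠` and `u = e_n(𝔞) ∈ K(𝔤)`; `Log` = the Iwasawa
branch ("any branch": `u` is a unit). -/
def unitLogSum (ι : PadicAlgCl p ≃+* ℂ) (ιK : K →+* ℂ) (𝔤 : Ideal (𝓞 K))
    (χ : RayGal K 𝔤 →* ℂˣ) (u : rayClassField K 𝔤) : ℂ_[p] :=
  ∑ g : RayGal K 𝔤,
    cval ι (χ g) * PadicComplex.iwasawaLog p (pEmb ι ιK ((g u : rayClassField K 𝔤) : AlgebraicClosure K))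

/-! ## §4 One table entry: de Shalit II.5.2 (4) at exact `𝔭`-level `n ≥ 1`

`12 · (χ⁻¹(𝔞) − N𝔞) · ∫ χ⁻¹ dμ = G(χ⁻¹) · Σ_g χ(g) log(g·e_n(𝔞))` — the Euler factors
`(1 − χ(𝔭))`, `(1 − χ⁻¹(𝔭)/p)` of (2)/(4) are `1` because `χ(𝔭) = 0` (χ ramified at 𝔭). -/
def CosetValueIdentity (ι : PadicAlgCl p ≃+* ℂ) (ιK : K →+* ℂ) (𝔤 : Ideal (𝓞 K)) (n : ℕ)
    (𝔞 : Ideal (𝓞 K)) (χ : RayGal K 𝔤 →* ℂˣ) (u : rayClassField K 𝔤)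
    (γ₀ : absoluteGaloisGroup K) (ζ : AlgebraicClosure K) (α : (ZMod (p ^ n))ˣ → 𝓞 K)
    {𝒰 : SubgroupTower (absoluteGaloisGroup K)} (μ : GroupDistribution 𝒰 ℂ_[p]) : Prop :=
  12 * (cval ι (χ (artinSymbol (galFrob K (rayClassField K 𝔤)) 𝔞))⁻¹ - (Ideal.absNorm 𝔞 : ℂ_[p])) *
      μ.integral (galCharInv ι 𝔤 χ) =
    gaussSumInv ι ιK 𝔤 n χ γ₀ ζ α * unitLogSum ι ιK 𝔤 χ u

/-- **A′ = «(KLF-COSET)₂», the conjunct.**  For the witness `μ = μ(S^∞·v̄^∞)` of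
`thmII414_exists_lMeasure`: for every complex embedding `ιK` inducing `v` through `ι`, every honest
modulus `𝔣` prime to `v` with support EXACTLY `S ∪ {v̄}` (so `L_{p,S^∞v̄^∞} = L_{p,𝔣}` by II.4.12 (32))
and `w_𝔣 = 1`, every level `n ≥ 1`, every `𝔞` prime to `6𝔤` (`𝔤 = 𝔣vⁿ`), the unit
`u = e_n(𝔞) = Θ(1; 𝔤, 𝔞) ∈ K(𝔤)` (II.2.4 (i); lattice `ιK(𝔤)`, `Θ` = `PeriodPair.deShalitTheta`),
every character `χ` of `Gal(K(𝔤)/K)` of EXACT `v`-level `n` whose `χ̂⁻¹` is `𝒰`-tower-continuous,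
the orientation `ζ`, any `γ₀` over `(𝔭ⁿ, K(𝔣v̄^m)/K)` for all `m`, any `κ`-representatives `α`:
the identity II.5.2 (4) holds.  [cite: deShalit1987, II.5.2 Theorem, proof eq. (3)–(4); II.4.11
(30); II.4.8 (19); II.4.12 (32); II.4.4] -/
def IsCosetValues (ι : PadicAlgCl p ≃+* ℂ) (v vbar : HeightOneSpectrum (𝓞 K))
    (S : Finset (HeightOneSpectrum (𝓞 K))) (𝒰 : SubgroupTower (absoluteGaloisGroup K))
    (μ : GroupDistribution 𝒰 ℂ_[p]) : Prop :=
  ∀ (ιK : K →+* ℂ), (∀ k : 𝓞 K, k ∈ v.asIdeal ↔ ‖ι.symm (ιK (k : K))‖ < 1) →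
  ∀ (𝔣 : Ideal (𝓞 K)) (n : ℕ), 1 ≤ n → 𝔣 ≠ ⊥ → IsCoprime 𝔣 v.asIdeal →
    (∀ w : HeightOneSpectrum (𝓞 K), w.asIdeal ∣ 𝔣 ↔ (w ∈ S ∨ w = vbar)) →
    rootsOfUnityCongruentOne 𝔣 = 1 →
  ∀ (𝔞 : Ideal (𝓞 K)), IsCoprime 𝔞 (Ideal.span {(6 : 𝓞 K)} * (𝔣 * v.asIdeal ^ n)) →
  ∀ (L La : PeriodPair) (T : Finset ℂ),
    (∀ z : ℂ, z ∈ L.lattice ↔ ∃ a ∈ 𝔣 * v.asIdeal ^ n, z = ιK (a : K)) →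
    La.lattice = idealInvLattice ιK 𝔞 L.lattice → L.IsLatticeReps La T →
  ∀ (u : rayClassField K (𝔣 * v.asIdeal ^ n)),
    algClosureEmb ιK (u : AlgebraicClosure K) = L.deShalitTheta La T 1 →
  ∀ (χ : RayGal K (𝔣 * v.asIdeal ^ n) →* ℂˣ),
    (∃ δ ∈ relGalSet K (𝔣 * v.asIdeal ^ n) (𝔣 * v.asIdeal ^ (n - 1)), χ δ ≠ 1) →
    𝒰.IsTowerContinuous (galCharInv ι (𝔣 * v.asIdeal ^ n) χ) →
  ∀ (ζ : AlgebraicClosure K),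
    algClosureEmb ιK ζ = Complex.exp (2 * Real.pi * Complex.I / (p : ℂ) ^ n) →
  ∀ (γ₀ : absoluteGaloisGroup K),
    (∀ m : ℕ, absRestrictNormalHom (rayClassField K (𝔣 * vbar.asIdeal ^ m)) γ₀ =
      artinSymbol (galFrob K (rayClassField K (𝔣 * vbar.asIdeal ^ m))) (v.asIdeal ^ n)) →
  ∀ (α : (ZMod (p ^ n))ˣ → 𝓞 K),
    (∀ a, α a - 1 ∈ 𝔣 ∧ α a - ((a : ZMod (p ^ n)).val : 𝓞 K) ∈ v.asIdeal ^ n) →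
  CosetValueIdentity ι ιK (𝔣 * v.asIdeal ^ n) n 𝔞 χ u γ₀ ζ α μ

/-! ## §5 The strengthened fact (ONE fact, SAME `μ`; +1 TEXT, cite count unchanged) and `A′ → A` -/

/-- **de Shalit II.4.14 + II.5.2 on one witness.**  Verbatim `DeShalit1987.thmII414_exists_lMeasure`
with `∧ IsCosetValues ι v vbar S 𝒰 μ` appended inside the inner existential — the cone (II.4.14,
`IsLMeasure`, types `(k,j)`, `0 ≤ −j < k`, i.e. `j < m`) and the finite-order `𝔭`-ramified cosets
(II.5.2 (4), type `(0,0)`, OUTSIDE the cone) are values of the same measure `μ(𝔣)`.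
[cite: deShalit1987, II.4.14 Theorem; II.5.2 Theorem eq. (4)] -/
def thmII414_exists_lMeasure_cosetValues : Prop :=
  ∀ (p : ℕ) [Fact p.Prime] (K : Type) [Field K] [NumberField K], IsImaginaryQuadratic K →
    ∀ (ι : PadicAlgCl p ≃+* ℂ) (v vbar : HeightOneSpectrum (𝓞 K)),
      ((p : ℕ) : 𝓞 K) ∈ v.asIdeal → ((p : ℕ) : 𝓞 K) ∈ vbar.asIdeal → vbar ≠ v →
      (∀ (w : InfinitePlace K) (k : 𝓞 K), k ∈ v.asIdeal ↔ ‖ι.symm (w.embedding (k : K))‖ < 1) →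
    ∃ (Ω δ : ℂ) (Ωp : (unrIntegers p)ˣ), Ω ≠ 0 ∧
      (δ ^ 2 = (NumberField.discr K : ℂ) ∨ δ ^ 2 = -(NumberField.discr K : ℂ)) ∧
      ∀ (S : Finset (HeightOneSpectrum (𝓞 K))), v ∉ S → vbar ∉ S →
        ∃ (𝒰 : SubgroupTower (absoluteGaloisGroup K)) (μ : GroupDistribution 𝒰 ℂ_[p]),
          (∀ n, IsOpen (𝒰.U n : Set (absoluteGaloisGroup K))) ∧
          (⋂ n, (𝒰.U n : Set (absoluteGaloisGroup K))) ⊆ DeShalit1987.rayKer K p S ∧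
          μ.bound ≤ 1 ∧
          DeShalit1987.IsLMeasure ι v vbar S Ω δ ((Ωp : unrIntegers p) : ℂ_[p]) 𝒰 μ ∧
          IsCosetValues ι v vbar S 𝒰 μ

/-- **Projection `A′ → A`** (kernel): the strengthened fact implies the existing named fact, so the
crux's antecedent / the route's cite list are untouched (`exists_of_exists_and` shape). -/
theorem thmII414_exists_lMeasure_of_cosetValues (h : thmII414_exists_lMeasure_cosetValues) :
    DeShalit1987.thmII414_exists_lMeasure := by
  intro p _ K _ _ hK ι v vbar hv hvbar hne hιv
  obtain ⟨Ω, δ, Ωp, hΩ, hδ, hS⟩ := h p K hK ι v vbar hv hvbar hne hιv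
  refine ⟨Ω, δ, Ωp, hΩ, hδ, fun S hvS hvbarS ↦ ?_⟩
  obtain ⟨𝒰, μ, h1, h2, h3, h4, -⟩ := hS S hvS hvbarS
  exact ⟨𝒰, μ, h1, h2, h3, h4⟩

/-- **Projection to the second conjunct** (kernel): what the LOWER junction (row 107 / R197a″)
consumes — for every admissible `S`, a measure that is BOTH an L-measure and has the coset values. -/
theorem exists_isLMeasure_and_isCosetValues (h : thmII414_exists_lMeasure_cosetValues)
    (hK : IsImaginaryQuadratic K) (ι : PadicAlgCl p ≃+* ℂ) (v vbar : HeightOneSpectrum (𝓞 K))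
    (hv : ((p : ℕ) : 𝓞 K) ∈ v.asIdeal) (hvbar : ((p : ℕ) : 𝓞 K) ∈ vbar.asIdeal) (hne : vbar ≠ v)
    (hιv : ∀ (w : InfinitePlace K) (k : 𝓞 K), k ∈ v.asIdeal ↔ ‖ι.symm (w.embedding (k : K))‖ < 1) :
    ∃ (Ω δ : ℂ) (Ωp : (unrIntegers p)ˣ), Ω ≠ 0 ∧
      ∀ (S : Finset (HeightOneSpectrum (𝓞 K))), v ∉ S → vbar ∉ S →
        ∃ (𝒰 : SubgroupTower (absoluteGaloisGroup K)) (μ : GroupDistribution 𝒰 ℂ_[p]),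
          (⋂ n, (𝒰.U n : Set (absoluteGaloisGroup K))) ⊆ DeShalit1987.rayKer K p S ∧ μ.bound ≤ 1 ∧
          DeShalit1987.IsLMeasure ι v vbar S Ω δ ((Ωp : unrIntegers p) : ℂ_[p]) 𝒰 μ ∧
          IsCosetValues ι v vbar S 𝒰 μ := by
  obtain ⟨Ω, δ, Ωp, hΩ, -, hS⟩ := h p K hK ι v vbar hv hvbar hne hιv
  refine ⟨Ω, δ, Ωp, hΩ, fun S hvS hvbarS ↦ ?_⟩
  obtain ⟨𝒰, μ, -, h2, h3, h4, h5⟩ := hS S hvS hvbarS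
  exact ⟨𝒰, μ, h2, h3, h4, h5⟩

/-! ## §6 Kernel helpers in the frame's currency `∫ρ dμ = c(key) · Σ ρ⁻¹(σ) log σu` -/

/-- **Frame form of one table entry** (kernel): with `ρ = χ̂⁻¹`, the identity reads
`∫ ρ dμ = c · Σ_g ρ⁻¹(g) Log j_p(g u)` with the NAMED constant
`c = G(χ⁻¹) / (12 (χ⁻¹(𝔞) − N𝔞))` — the shape `∫ρ_v dμ = c(key)·Σ ρ_v⁻¹(σ) log σu` of k3-g29's
`OutOfRangeLogLaw` / row 84 (B65: constants named, not netted). -/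
theorem integral_eq_const_mul_unitLogSum {ι : PadicAlgCl p ≃+* ℂ} {ιK : K →+* ℂ}
    {𝔤 : Ideal (𝓞 K)} {n : ℕ} {𝔞 : Ideal (𝓞 K)} {χ : RayGal K 𝔤 →* ℂˣ} {u : rayClassField K 𝔤}
    {γ₀ : absoluteGaloisGroup K} {ζ : AlgebraicClosure K} {α : (ZMod (p ^ n))ˣ → 𝓞 K}
    {𝒰 : SubgroupTower (absoluteGaloisGroup K)} {μ : GroupDistribution 𝒰 ℂ_[p]}
    (h : CosetValueIdentity ι ιK 𝔤 n 𝔞 χ u γ₀ ζ α μ)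
    (hc : 12 * (cval ι (χ (artinSymbol (galFrob K (rayClassField K 𝔤)) 𝔞))⁻¹ -
      (Ideal.absNorm 𝔞 : ℂ_[p])) ≠ 0) :
    μ.integral (galCharInv ι 𝔤 χ) =
      (12 * (cval ι (χ (artinSymbol (galFrob K (rayClassField K 𝔤)) 𝔞))⁻¹ -
        (Ideal.absNorm 𝔞 : ℂ_[p])))⁻¹ * gaussSumInv ι ιK 𝔤 n χ γ₀ ζ α * unitLogSum ι ιK 𝔤 χ u := by
  unfold CosetValueIdentity at h
  rw [mul_assoc, ← h, ← mul_assoc, inv_mul_cancel₀ hc, one_mul]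

/-- **The smoothing factor never vanishes for `N𝔞 ≥ 2`** (kernel): `χ⁻¹(𝔞)` is a root of unity
(`|·| = 1` in `ℂ`), `N𝔞 ≥ 2`, and `ι⁻¹` is injective — so the division in
`integral_eq_const_mul_unitLogSum` is legitimate for every `𝔞 ≠ 𝒪_K`. -/
theorem smoothingFactor_ne_zero (ι : PadicAlgCl p ≃+* ℂ) {𝔤 : Ideal (𝓞 K)}
    (χ : RayGal K 𝔤 →* ℂˣ) (g : RayGal K 𝔤) {N : ℕ} (hN : 2 ≤ N) :
    12 * (cval ι (χ g)⁻¹ - (N : ℂ_[p])) ≠ 0 := by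
  have hfin : IsOfFinOrder (χ g)⁻¹ :=
    isOfFinOrder_inv_iff.mpr (χ.isOfFinOrder (isOfFinOrder_of_finite g))
  have hnorm : ‖(((χ g)⁻¹ : ℂˣ) : ℂ)‖ = 1 := by
    obtain ⟨k, hk, hk1⟩ := hfin.exists_pow_eq_one
    have h1 : ‖(((χ g)⁻¹ : ℂˣ) : ℂ)‖ ^ k = 1 := by
      rw [← norm_pow, ← Units.val_pow_eq_pow_val, hk1, Units.val_one, norm_one]
    exact (pow_eq_one_iff_of_nonneg (norm_nonneg _) hk.ne').mp h1
  have hneC : (((χ g)⁻¹ : ℂˣ) : ℂ) ≠ (N : ℂ) := by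
    intro h
    have : ‖(N : ℂ)‖ = 1 := h ▸ hnorm
    rw [Complex.norm_natCast] at this
    have : (N : ℝ) = 1 := this
    norm_cast at this
    omega
  refine mul_ne_zero (by norm_num) (sub_ne_zero.mpr ?_)
  intro h
  apply hneC
  unfold cval at h
  have h1 : ((ι.symm (((χ g)⁻¹ : ℂˣ) : ℂ) : PadicAlgCl p) : ℂ_[p]) = ((N : PadicAlgCl p) : ℂ_[p]) := by
    rw [PadicComplex.coe_natCast]; exact h
  rw [PadicComplex.coe_eq, PadicComplex.coe_eq] at h1
  have h' : (ι.symm (((χ g)⁻¹ : ℂˣ) : ℂ) : PadicAlgCl p) = (N : PadicAlgCl p) :=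
    (algebraMap (PadicAlgCl p) ℂ_[p]).injective h1
  have := congrArg ι h'
  simpa using this

omit [NumberField K] in
/-- **`κ`-representatives exist** (kernel, CRT): `𝔣 + vⁿ = 1` gives, for every `a`, an `α` with
`α ≡ 1 (𝔣)` and `α ≡ a (vⁿ)` — so the `α`-binder of `IsCosetValues` is never vacuous. -/
theorem exists_kappaReps (𝔣 P : Ideal (𝓞 K)) (h : IsCoprime 𝔣 P) (n : ℕ) (m : ℕ) :
    ∃ α : 𝓞 K, α - 1 ∈ 𝔣 ∧ α - (m : 𝓞 K) ∈ P ^ n := by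
  have hn : IsCoprime 𝔣 (P ^ n) := h.pow_right
  obtain ⟨x, hx, y, hy, hxy⟩ := Ideal.isCoprime_iff_exists.mp hn
  refine ⟨1 + ((m : 𝓞 K) - 1) * x, ?_, ?_⟩
  · have : 1 + ((m : 𝓞 K) - 1) * x - 1 = ((m : 𝓞 K) - 1) * x := by ring
    rw [this]; exact 𝔣.mul_mem_left _ hx
  · have : 1 + ((m : 𝓞 K) - 1) * x - (m : 𝓞 K) = -(((m : 𝓞 K) - 1) * y) := by
      have hx' : x = 1 - y := by rw [← hxy]; ring
      rw [hx']; ring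
    rw [this]; exact (P ^ n).neg_mem ((P ^ n).mul_mem_left _ hy)

/-! ## §7 Helper-lemma SIGNATURES for the stub prover (shapes only; `sorry` = not claimed here) -/

/-- H1 (S, CFT/compactness): a lift `γ₀ ∈ Γ_K` of the compatible Artin symbols `(𝔭ⁿ, K(𝔣v̄^m)/K)`,
`m ≥ 0`, exists — so the `γ₀`-binder of `IsCosetValues` is never vacuous. -/
theorem stubsig_exists_frobLift (𝔣 : Ideal (𝓞 K)) (h𝔣 : 𝔣 ≠ ⊥) (v vbar : HeightOneSpectrum (𝓞 K))
    (hv : IsCoprime 𝔣 v.asIdeal) (hne : vbar ≠ v) (n : ℕ) :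
    ∃ γ₀ : absoluteGaloisGroup K, ∀ m : ℕ,
      absRestrictNormalHom (rayClassField K (𝔣 * vbar.asIdeal ^ m)) γ₀ =
        artinSymbol (galFrob K (rayClassField K (𝔣 * vbar.asIdeal ^ m))) (v.asIdeal ^ n) := by
  sorry

/-- H2 (S, CFT): `rayKer K p S ≤ ker(Γ_K → Gal(K(𝔤)/K))` when `supp 𝔤 ⊆ S ∪ {v, v̄}` — whence the
tower-continuity hypothesis of `IsCosetValues` is DISCHARGED for the fact's `𝒰` (`⋂ U_n ⊆ rayKer`,
`U_n` open, `SubgroupTower.exists_subset_of_isOpen`; cf. `isTowerContinuous_avatarValueAt`). -/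
theorem stubsig_rayKer_le_ker (S : Finset (HeightOneSpectrum (𝓞 K))) (v vbar : HeightOneSpectrum (𝓞 K))
    (hv : ((p : ℕ) : 𝓞 K) ∈ v.asIdeal) (hvbar : ((p : ℕ) : 𝓞 K) ∈ vbar.asIdeal)
    (𝔤 : Ideal (𝓞 K)) (h𝔤 : 𝔤 ≠ ⊥)
    (hsupp : ∀ w : HeightOneSpectrum (𝓞 K), w.asIdeal ∣ 𝔤 → w ∈ S ∨ w = v ∨ w = vbar) :
    DeShalit1987.rayKer K p S ≤ (absRestrictNormalHom (rayClassField K 𝔤)).ker := by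
  sorry

/-- H3 (XS, from II.2.4 (i) = `DeShalit1987.prop24_i_mem_rayClassField`): the unit binder is never
vacuous — `e_n(𝔞) = Θ(1; 𝔤, 𝔞)` lies in `ι̂(K(𝔤))` (lattice `ιK(𝔤)` is a CM lattice and `1` is a
primitive `𝔤`-division point of it; `exists_mem_rayClassField_eq_deShalitTheta`). -/
theorem stubsig_exists_unit (h24 : DeShalit1987.prop24_i_mem_rayClassField)
    (hK : IsImaginaryQuadratic K) (ιK : K →+* ℂ) (𝔤 𝔞 : Ideal (𝓞 K)) (h𝔤 : 𝔤 ≠ ⊥) (h𝔤' : 𝔤 ≠ ⊤)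
    (h𝔞 : 𝔞 ≠ ⊥) (hcop : IsCoprime 𝔞 (Ideal.span {(6 : 𝓞 K)} * 𝔤)) (L La : PeriodPair) (T : Finset ℂ)
    (hL : ∀ z : ℂ, z ∈ L.lattice ↔ ∃ a ∈ 𝔤, z = ιK (a : K))
    (hLa : La.lattice = idealInvLattice ιK 𝔞 L.lattice) (hT : L.IsLatticeReps La T) :
    ∃ u : rayClassField K 𝔤, algClosureEmb ιK (u : AlgebraicClosure K) = L.deShalitTheta La T 1 := by
  sorry

/-- H4 (S, size bookkeeping at `p = 2`; Gauss VALUATIONS are known and NAMED, netted only on the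
cut — k2-g13, k2-g6): for `χ` of exact `v`-level `n ∈ {2, 3}` over `K_v = ℚ₂`,
`v₂(G(χ⁻¹)) = −n + n/2 = −n/2`, i.e. `‖G(χ⁻¹)‖_{ℂ₂} = 2^{n/2}` (`G = 2⁻ⁿ·(root of unity)·τ′` with
`τ′` an ordinary Gauss sum of a primitive character mod `2ⁿ`: `τ′² = χ(−1)·2ⁿ` for the (real)
characters of conductor 4, 8, so `v₂(τ′) = n/2`; complex size `GḠ = p^{n(k−1)}` at `k = 0`,
II.4.11 Remark (i)). Stated as the norm identity the LOWER ledger consumes. -/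
theorem stubsig_norm_gaussSumInv_two (ι : PadicAlgCl 2 ≃+* ℂ) (ιK : K →+* ℂ) (𝔣 : Ideal (𝓞 K))
    (v : HeightOneSpectrum (𝓞 K)) (n : ℕ) (hn : n = 2 ∨ n = 3)
    (χ : RayGal K (𝔣 * v.asIdeal ^ n) →* ℂˣ)
    (hχ : ∃ δ ∈ relGalSet K (𝔣 * v.asIdeal ^ n) (𝔣 * v.asIdeal ^ (n - 1)), χ δ ≠ 1)
    (γ₀ : absoluteGaloisGroup K) (ζ : AlgebraicClosure K)
    (hζ : algClosureEmb ιK ζ = Complex.exp (2 * Real.pi * Complex.I / (2 : ℂ) ^ n))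
    (α : (ZMod (2 ^ n))ˣ → 𝓞 K)
    (hα : ∀ a, α a - 1 ∈ 𝔣 ∧ α a - ((a : ZMod (2 ^ n)).val : 𝓞 K) ∈ v.asIdeal ^ n) :
    ‖gaussSumInv ι ιK (𝔣 * v.asIdeal ^ n) n χ γ₀ ζ α‖ = (2 : ℝ) ^ ((n : ℝ) / 2) := by
  sorry

end Summit.BirchSwinnertonDyer.BirchSwinnertonDyer.Cruxes.SplitBadTwoLowerHalfOfFacts.CosetValuesK2G40
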